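/-
Copyright (c) 2026 the pub-hodgecm-mathlib formalisation cell (harness21).  Prover seat hodgecm-mathlib-K2Liu-p08 (g4), Track B «K2-LIT» ∕ hLiu418
#184♮, socket #42S organ S1 (ROAD W), brick F7∕F8 (T3-frame, inert reading) (LEAD F0P6-plan (g14) BATCH #8 (4) «the inert bridge `LocalRing L v ≃ L_{w₀}`
at non-split v: p08 … files `K2LiuLocalRingInertReading` FIRST as the twin of ★ p860045»; K2Liu-p01 (g8) SPEC-F7-FrameStep ab42186030930277 §2 (i-c)).  2026-09-04.  KERNEL: theorems only.
-/
import Literature.NumberTheory.Automorphic.UnitaryGroupNonsplitPlace                -- ★ `PlacesOver.eq_of_smul_eq`, `galInv_eq_self_of_smul_eq`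
import Literature.NumberTheory.Automorphic.UnitaryGroupInertPlaceHyperbolicBasis    -- ★ `galAdicCompletionMap_galAdicCompletionMap_of_smul_eq` (σ_w² = id)
import Mathlib.LinearAlgebra.Matrix.Hermitian
import HarnessLib

/-!
# Crux `HLiu418`, #42S-S1 ROAD W, brick (T3-frame, inert reading): `E ⊗ F_v = E_{w₀}` AT A NON-SPLIT PLACE, BY EVALUATION

Cell `hodgecm-mathlib`, crux item hLiu418 = `stmt-HodgeConjecture-24832` (helper lane `--supports … --as helper`, count-neutral).  THEOREMS ONLY (no `def`, no instance,
no notation, no named-fact hypothesis, no `sorry`).  The NON-SPLIT twin of ★ p860045 `K2LiuLocalRingSplitReading` (asked by name in LEAD BATCH #8 (4) for K2Liu-p01 (g8)'s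
(T3-frame)(i-c) `tau_trace_dual_herm` and (iii) `cells_equiv`): at a place `v` of `F` with `c • w₀ = w₀` (inert or ramified) `w₀` is the ONLY place of `E` above `v`
(★ `PlacesOver.eq_of_smul_eq`), so the evaluation `ρ := Pi.evalRingHom _ w₀ : LocalRing E v = Π_{w ∣ v} E_w →+* E_{w₀}` (a Mathlib term, no `def`) is a ring ISOMORPHISM carrying
`σ = conjLocal E c v = c ⊗ 1` to the local involution `σ_{w₀} = galAdicCompletionMap c hw₀` of ★ `UnitaryGroupInertPlaceHyperbolicBasis`, valuations verbatim, and the hermitian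
Gram `G = Aσ(B)ᵀ + Bσ(A)ᵀ + d·Cσ(C)ᵀ` of ★ (T3a) to the same expression over `E_{w₀}` with `σ_{w₀}` — the currency of ★ F7b-inst ∕ ★ (T3-core) (`O = 𝒪_{w₀}`, `σ := σ_{w₀}|_O`
via ★ `galAdicCompletionMap_mem_integer`):
* §1 `inert_reading_apply`, **`conjLocal_apply_of_smul_eq`** (`(σz)(w₀) = σ_{w₀}(z(w₀))`), `inert_reading_injective`, `inert_reading_surjective`, **`forall_valued_le_iff_of_smul_eq`**
  («`∀ w ∣ v, v_w(z(w)) ≤ r`» ↔ «`v(z(w₀)) ≤ r`»), `forall_places_iff_of_smul_eq`;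
* §2 **`inert_reading_gram`**: `(G i j)(w₀) = (A′σ_{w₀}(B′)ᵀ + B′σ_{w₀}(A′)ᵀ + d′·C′σ_{w₀}(C′)ᵀ) i j`, `X′ k = X k (w₀)`; **`forall_valued_gram_le_iff_of_smul_eq`**.
[CasselsFrohlichANT1967, Ch. II §10–§11, Ch. VII §1.1 & Prop. 1.2 (ii)] [Shimura1997, §13.2].
HONEST LABEL.  Count-neutral helper; `HC_CM` is proved only modulo the 7 printed citations (2 remaining named inputs: hLiu418 = `stmt-HodgeConjecture-24832`,
h413 = `stmt-HodgeConjecture-24833`) until rung 0 closes.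

## References
* [CasselsFrohlichANT1967] J. W. S. Cassels, A. Fröhlich (eds.), *Algebraic Number Theory* (1967), Ch. II §10–§11, Ch. VII §1.1, Prop. 1.2 (ii).
* [Shimura1997] G. Shimura, *Euler products and Eisenstein series*, CBMS 93 (1997), §13.2.
-/

set_option autoImplicit false
set_option linter.dupNamespace false -- the mandated namespace repeats `HodgeConjecture.HodgeConjecture`

open Matrix
open Literature.NumberTheory.Automorphic Literature.NumberTheory.Automorphic.UnitaryGroup

namespace Summit.HodgeConjecture.HodgeConjecture.Cruxes.HLiu418.K2LiuLocalRingInertReading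

variable {F E : Type} [Field F] [NumberField F] [Field E] [NumberField E] [Algebra F E] [Algebra.IsQuadraticExtension F E]
  (c : E ≃ₐ[F] E) (hc : c ≠ 1) (v : IsDedekindDomain.HeightOneSpectrum (NumberField.RingOfIntegers F))
  (w₀ : PlacesOver E v) (hw₀ : c • w₀.1 = w₀.1)

/-! ## §1 Evaluation at the unique place is a ring isomorphism carrying `σ` to `σ_{w₀}` -/

omit [NumberField F] [Algebra.IsQuadraticExtension F E] in
/-- the reading is evaluation: `ρ z = z(w₀)`. [folklore] -/
theorem inert_reading_apply (z : LocalRing E v) :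
    Pi.evalRingHom (fun w : PlacesOver E v => w.1.adicCompletion E) w₀ z = z w₀ := rfl

include hc hw₀ in
/-- at a non-split place every statement about all `w ∣ v` is the statement at `w₀`. [cite: CasselsFrohlichANT1967, Ch. VII Prop. 1.2 (ii)] -/
theorem forall_places_iff_of_smul_eq (P : PlacesOver E v → Prop) : (∀ w, P w) ↔ P w₀ :=
  ⟨fun h => h w₀, fun h w => by rw [PlacesOver.eq_of_smul_eq c hc w₀ hw₀ w]; exact h⟩

include hc hw₀ in
/-- **`σ` READS AS THE LOCAL INVOLUTION**: `(σz)(w₀) = σ_{w₀}(z(w₀))`, `σ_{w₀} = galAdicCompletionMap c hw₀` (the conjugate place `c⁻¹ • w₀` IS `w₀`).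
[cite: CasselsFrohlichANT1967, Ch. VII §1.1] -/
theorem conjLocal_apply_of_smul_eq (z : LocalRing E v) : conjLocal E c v z w₀ = galAdicCompletionMap c hw₀ (z w₀) := by
  rw [conjLocal_apply]
  have key : ∀ (w' : PlacesOver E v) (h' : c • w'.1 = w₀.1), w' = w₀ → galAdicCompletionMap c h' (z w') = galAdicCompletionMap c hw₀ (z w₀) := by
    rintro w' h' rfl
    rfl
  exact key ⟨c⁻¹ • w₀.1, under_inv_smul_eq c w₀⟩ (smul_inv_smul c w₀.1) (PlacesOver.eq_of_smul_eq c hc w₀ hw₀ _)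

include hc hw₀ in
/-- **the reading is injective** (one place above `v`). [cite: CasselsFrohlichANT1967, Ch. II §10–§11] -/
theorem inert_reading_injective : Function.Injective (Pi.evalRingHom (fun w : PlacesOver E v => w.1.adicCompletion E) w₀) := by
  intro z z' h
  funext w
  rw [PlacesOver.eq_of_smul_eq c hc w₀ hw₀ w]
  exact h

omit [NumberField F] [Algebra.IsQuadraticExtension F E] in
/-- **the reading is surjective** (`a ↦ δ_{w₀}(a)`). [cite: CasselsFrohlichANT1967, Ch. II §10–§11] -/
theorem inert_reading_surjective : Function.Surjective (Pi.evalRingHom (fun w : PlacesOver E v => w.1.adicCompletion E) w₀) := by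
  classical
  intro a
  exact ⟨Pi.single (M := fun w : PlacesOver E v => w.1.adicCompletion E) w₀ a, Pi.single_eq_same (M := fun w : PlacesOver E v => w.1.adicCompletion E) w₀ a⟩

include hc hw₀ in
/-- **VALUATION CONDITIONS READ AT `w₀`**: «`∀ w ∣ v, v_w(z(w)) ≤ r w`» ↔ «`v(z(w₀)) ≤ r w₀`» (any family of bounds `r`, e.g. `r w = v(ι_w π)^a` of ★ `K2LiuLocalRingValuationBalls`).
[cite: CasselsFrohlichANT1967, Ch. II §10–§11] -/
theorem forall_valued_le_iff_of_smul_eq (z : LocalRing E v) (r : (w : PlacesOver E v) → WithZero (Multiplicative ℤ)) :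
    (∀ w : PlacesOver E v, Valued.v (z w) ≤ r w) ↔ Valued.v (z w₀) ≤ r w₀ :=
  forall_places_iff_of_smul_eq c hc v w₀ hw₀ _

include hc hw₀ in
/-- the involution `σ_{w₀}` is valuation-preserving and squares to the identity (★ `valued_galAdicCompletionMap`, ★ `galAdicCompletionMap_galAdicCompletionMap_of_smul_eq`) — recorded
in the reading's letters. [cite: CasselsFrohlichANT1967, Ch. VII §1.1] -/
theorem valued_conjLocal_apply_of_smul_eq (z : LocalRing E v) : Valued.v (conjLocal E c v z w₀) = Valued.v (z w₀) := by
  rw [conjLocal_apply_of_smul_eq c hc v w₀ hw₀, valued_galAdicCompletionMap]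

/-! ## §2 The hermitian Gram reads verbatim with `σ_{w₀}` -/

include hc hw₀ in
/-- **THE GRAM AT `w₀`**: with `X′ k = X k (w₀)` and `σ_{w₀} = galAdicCompletionMap c hw₀`,
`(Aσ(B)ᵀ + Bσ(A)ᵀ + d·Cσ(C)ᵀ)_{ij}(w₀) = (A′σ_{w₀}(B′)ᵀ + B′σ_{w₀}(A′)ᵀ + d(w₀)·C′σ_{w₀}(C′)ᵀ)_{ij}` — ★ (T3-core)'s Gram over `𝒪_{w₀}` with `σ := σ_{w₀}`. [cite: Shimura1997, §13.2] -/
theorem inert_reading_gram (d : LocalRing E v) (A B C : Fin 2 → LocalRing E v) (i j : Fin 2) :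
    ((vecMulVec A (fun k => conjLocal E c v (B k)) + vecMulVec B (fun k => conjLocal E c v (A k)) + d • vecMulVec C (fun k => conjLocal E c v (C k))) i j) w₀ =
      (vecMulVec (fun k => A k w₀) (fun k => galAdicCompletionMap c hw₀ (B k w₀)) + vecMulVec (fun k => B k w₀) (fun k => galAdicCompletionMap c hw₀ (A k w₀)) +
        d w₀ • vecMulVec (fun k => C k w₀) (fun k => galAdicCompletionMap c hw₀ (C k w₀))) i j := by
  simp only [Matrix.add_apply, Matrix.smul_apply, Matrix.vecMulVec_apply, Pi.add_apply, Pi.mul_apply, smul_eq_mul, conjLocal_apply_of_smul_eq c hc v w₀ hw₀]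

include hc hw₀ in
/-- **THE GRAM CONDITION READS AT `w₀`**: for any family of bounds `r`,
«`∀ i j, ∀ w ∣ v, v_w((G i j)(w)) ≤ r w`» ↔ «`∀ i j, v((G′ i j)) ≤ r w₀`», `G′` the Gram over `E_{w₀}` with `σ_{w₀}`. [cite: Shimura1997, §13.2] -/
theorem forall_valued_gram_le_iff_of_smul_eq (d : LocalRing E v) (A B C : Fin 2 → LocalRing E v) (r : (w : PlacesOver E v) → WithZero (Multiplicative ℤ)) :
    (∀ i j, ∀ w : PlacesOver E v,
        Valued.v (((vecMulVec A (fun k => conjLocal E c v (B k)) + vecMulVec B (fun k => conjLocal E c v (A k)) + d • vecMulVec C (fun k => conjLocal E c v (C k))) i j) w) ≤ r w) ↔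
      ∀ i j, Valued.v ((vecMulVec (fun k => A k w₀) (fun k => galAdicCompletionMap c hw₀ (B k w₀)) +
          vecMulVec (fun k => B k w₀) (fun k => galAdicCompletionMap c hw₀ (A k w₀)) +
          d w₀ • vecMulVec (fun k => C k w₀) (fun k => galAdicCompletionMap c hw₀ (C k w₀))) i j) ≤ r w₀ := by
  refine forall_congr' fun i => forall_congr' fun j => ?_
  rw [forall_valued_le_iff_of_smul_eq c hc v w₀ hw₀, inert_reading_gram c hc v w₀ hw₀]

end Summit.HodgeConjecture.HodgeConjecture.Cruxes.HLiu418.K2LiuLocalRingInertReading
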